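import Literature.NumberTheory.Automorphic.ArthurClozelBaseChange
import HarnessLib

/-!
# The norm index `(𝔸_Fˣ : F^× N(𝔸_Eˣ))` from a class-field character; the first inequality as the input of Thm. 4.2 (b)

Topic `NumberTheory/Automorphic` (next to `ClassFieldCharacter`, which defines the norm group
`normGroup F E = F^× N(𝔸_E^×) ≤ 𝔸_F^×` of an extension of number fields and the class-field
characters `η` "vanishing exactly on `F^* N(𝔸_E^*)`" of Arthur–Clozel Ch. 3 §4, and to
`ArthurClozelBaseChange`, which records the class-field-theory input of Arthur–Clozel Ch. 3 as the
named fact `exists_isClassFieldCharacter`); namespace `Literature.NumberTheory.Automorphic`.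
Everything here is **proved**; no named facts.

Background. J. Tate, *Global class field theory* (Ch. VII of Cassels–Fröhlich, 1967), §8
"Cohomology of Idèle Classes (I), The First Inequality" (pp. 177–180) proves for a cyclic
extension `L/K` of global fields of degree `n`: **8.3** `h(G, C_L) = n`; **8.4 (first
inequality)** `[J_K : K^* N_{L/K} J_L] ≥ n`; **8.5/8.8** a non-trivial abelian extension has a
proper norm group and infinitely many primes that do not split completely; and §5.1 Main
Theorem (B) (reciprocity) gives `J_K / K^* N_{L/K} J_L ≅ G(L/K)`, in particular the norm index
equality `[J_K : K^* N_{L/K} J_L] = n`. In the tree, `K^* N_{L/K} J_L` is `normGroup F E`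
(`N y = ∏_{σ ∈ Gal(E/F)} σ • y` inside `𝔸_Eˣ`, pulled back along the injective
`ideleBaseChange`; Tate's Remark 8.6), indices are Mathlib's `Subgroup.index : ℕ` (`0` for
infinite index), and the reciprocity-level input is `exists_isClassFieldCharacter` (a cyclic
`E/F` has a Hecke character with kernel exactly `normGroup F E`, of order `[E : F]`).

This file proves:

* `index_normGroup_eq_finrank_of_isClassFieldCharacter` — **a class-field character of order
  `[E : F]` computes the norm index**: `(normGroup F E).index = [E : F]` (`𝔸_Fˣ / ker η ≃ η(𝔸_Fˣ)`,
  a subgroup of `μ_{[E:F]}(ℂ)` of exponent `ord(η)`); hence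
  `index_normGroup_eq_finrank_of_exists_isClassFieldCharacter`,
  `finrank_le_index_normGroup_of_exists_isClassFieldCharacter` (Tate's 8.4 in the rendering
  `[E : F] ≤ (normGroup F E).index`, as a *consequence* of the tree's reciprocity-level fact) and
  `normGroup_ne_top_of_exists_isClassFieldCharacter`;
* `normGroup_ne_top_of_finrank_le_index`, `exists_not_mem_normGroup_of_ne_top`,
  `IsClassFieldCharacter.ne_one_of_normGroup_ne_top`,
  `IsClassFieldCharacter.orderOf_eq_finrank_of_firstInequality` — the elementary passage from
  the first inequality `[E : F] ≤ index` (resp. the bare properness `normGroup F E ≠ ⊤`) to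
  "`η ≠ 1`" and, for `[E : F] = ℓ` prime, "`η` has order exactly `ℓ`" — the only use of class
  field theory in the clause `ℓ ∣ n` of Arthur–Clozel's Thm. 4.2 (b)
  (`ArthurClozel1989_dvd_of_twist_eq`; the reductions themselves are
  `arthurClozel1989_dvd_of_twist_eq_of_classField` /
  `arthurClozel1989_dvd_of_twist_eq_of_normGroup_ne_top` in `ArthurClozelBaseChangeProofs`).

So a future in-tree proof of the first inequality alone (Tate 8.3–8.4 via Herbrand quotients —
cf. `Literature/GroupTheory/Index/HerbrandLemma`, the local norm index
`GaloisRepresentations/CyclicNormIndex`, and the discharged quadratic case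
`QuadraticForms.OMeara65.two_le_normIdeles_index_holds`), in the form
`[E : F] ≤ (normGroup F E).index` or just `normGroup F E ≠ ⊤`, discharges
`ArthurClozel1989_dvd_of_twist_eq` without the reciprocity law. (D-0026: the first inequality is
deliberately *not* vendored here as a further named fact.)

## References

* J. Tate, *Global class field theory*, Ch. VII of J. W. S. Cassels, A. Fröhlich (eds.),
  *Algebraic Number Theory*, Academic Press (1967): §5.1 Main Theorem (B); §8, Thm. 8.3,
  Consequences 8.4, 8.5, Remark 8.6, Cor. 8.8 (pp. 177–180). [TateGCFT1967] [CasselsFrohlichANT1967]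
* J. Arthur, L. Clozel, *Simple algebras, base change, and the advanced theory of the trace
  formula*, Ann. of Math. Stud. 120 (1989), Ch. 3 §4 (the character `η`), Thm. 4.2 (b).
  [ArthurClozelAMS120]
-/

noncomputable section

namespace Literature.NumberTheory.Automorphic

open NumberField

/-! ### From the first inequality (or the properness of the norm group) to `ord(η) = ℓ` -/

section FirstInequality

variable {F E : Type*} [Field F] [Field E] [Algebra F E] [NumberField F] [NumberField E]
  [FiniteDimensional F E]

/-- **`F^× N(𝔸_E^×) ≠ 𝔸_F^×` from the first inequality**: if `[E : F] ≤ (normGroup F E).index`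
(Tate, Ch. VII of Cassels–Fröhlich, §8, Consequence 8.4 for `E/F` cyclic, with Mathlib's index
convention) and `E ≠ F`, the norm group is a proper subgroup (the idelic content of Tate's
Consequence 8.5 / Cor. 8.8). [cite: TateGCFT1967, §8 Consequences 8.4–8.5] -/
theorem normGroup_ne_top_of_finrank_le_index (h : Module.finrank F E ≤ (normGroup F E).index)
    (hEF : 1 < Module.finrank F E) : normGroup F E ≠ ⊤ := by
  intro htop
  rw [htop, Subgroup.index_top] at h
  omega

/-- A proper norm group misses some idele of `F` (not a global element times a norm). [folklore] -/
theorem exists_not_mem_normGroup_of_ne_top (h : normGroup F E ≠ ⊤) :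
    ∃ x : (AdeleRing (𝓞 F) F)ˣ, x ∉ normGroup F E := by
  by_contra hx
  push Not at hx
  exact h ((Subgroup.eq_top_iff' _).2 hx)

/-- **A class-field character is non-trivial as soon as the norm group is proper**: `η` vanishes
*exactly* on `F^× N(𝔸_E^×)` (`IsClassFieldCharacter.ne_one` of `ClassFieldCharacter`, fed with
`exists_not_mem_normGroup_of_ne_top`). [folklore] -/
theorem _root_.Literature.NumberTheory.GaloisRepresentations.HeckeCharacter.IsClassFieldCharacter.ne_one_of_normGroup_ne_top
    {η : Literature.NumberTheory.GaloisRepresentations.HeckeCharacter F} (hη : η.IsClassFieldCharacter E)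
    (h : normGroup F E ≠ ⊤) : η ≠ 1 := by
  obtain ⟨x, hx⟩ := exists_not_mem_normGroup_of_ne_top h
  exact hη.ne_one hx

/-- **A class-field character of a cyclic extension of prime degree `ℓ` has order `ℓ`, given the
first inequality** `[E : F] ≤ (normGroup F E).index` (Tate §8, Consequence 8.4): `η ^ ℓ = 1`
because every `ℓ`-th power is a norm (`IsTrivialOnNormGroup.pow_card`), and `η ≠ 1` because the
norm group is proper. Same statement as `IsClassFieldCharacter.orderOf_eq_finrank`
(`ArthurClozelBaseChangeProofs`, input: the reciprocity-level fact `exists_isClassFieldCharacter`)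
and as `IsClassFieldCharacter.orderOf_eq_finrank_of_normGroup_ne_top` (same file, input:
`normGroup F E ≠ ⊤`), here under the first inequality; it is the form "`η` has order exactly `l`"
in which Arthur–Clozel, Ch. 3, Thm. 4.2 (b) uses class field theory.
[cite: TateGCFT1967, §8 Consequence 8.4] -/
theorem _root_.Literature.NumberTheory.GaloisRepresentations.HeckeCharacter.IsClassFieldCharacter.orderOf_eq_finrank_of_firstInequality
    [IsGalois F E] (hℓ : (Module.finrank F E).Prime)
    {η : Literature.NumberTheory.GaloisRepresentations.HeckeCharacter F} (hη : η.IsClassFieldCharacter E)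
    (h : Module.finrank F E ≤ (normGroup F E).index) : orderOf η = Module.finrank F E := by
  haveI : Fact (Module.finrank F E).Prime := ⟨hℓ⟩
  have hpow : η ^ Module.finrank F E = 1 := by
    have hc := hη.isTrivialOnNormGroup.pow_card
    rwa [← Nat.card_eq_fintype_card, IsGalois.card_aut_eq_finrank] at hc
  rcases (Nat.dvd_prime hℓ).1 (orderOf_dvd_of_pow_eq_one hpow) with h1 | h1
  · exact absurd (orderOf_eq_one_iff.1 h1)
      (hη.ne_one_of_normGroup_ne_top (normGroup_ne_top_of_finrank_le_index h hℓ.one_lt))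
  · exact h1

end FirstInequality

/-! ### The norm index from a class-field character of order `[E : F]` -/

section Bridge

variable {F E : Type} [Field F] [NumberField F] [Field E] [NumberField E] [Algebra F E]
  [FiniteDimensional F E]

/-- **A class-field character of order `[E : F]` computes the norm index**: if the Hecke
character `η` vanishes *exactly* on `normGroup F E` and has order `[E : F]` in the group of Hecke
characters, then `(𝔸_Fˣ : F^× N(𝔸_Eˣ)) = [E : F]`. Indeed `η` induces
`𝔸_Fˣ / normGroup F E ≃ η(𝔸_Fˣ) ≤ ℂˣ` (kernel `= normGroup F E`); the image is killed by
`ord(η)` (`η^{ord η} = 1` pointwise), so it lies in `μ_{[E:F]}(ℂ)`, of order `[E : F]`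
(`Complex.card_rootsOfUnity`), whence `#η(𝔸_Fˣ) ∣ [E : F]`; conversely `η^{#η(𝔸_Fˣ)} = 1`
pointwise (Lagrange), so `[E : F] = ord(η) ∣ #η(𝔸_Fˣ)`. (This is how the reciprocity
isomorphism `𝔸_Fˣ/F^× N(𝔸_Eˣ) ≅ Gal(E/F)`, Tate §5.1 (B), contains the norm index equality
`[J_K : K^* N J_L] = [L : K]` of §8–§9.) [cite: TateGCFT1967, §5.1 Main Theorem (B) with §8 Consequence 8.4] -/
theorem index_normGroup_eq_finrank_of_isClassFieldCharacter
    {η : Literature.NumberTheory.GaloisRepresentations.HeckeCharacter F} (hη : η.IsClassFieldCharacter E)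
    (hord : orderOf η = Module.finrank F E) : (normGroup F E).index = Module.finrank F E := by
  classical
  set n := Module.finrank F E
  haveI : NeZero n := ⟨Module.finrank_pos.ne'⟩
  -- `η` as a monoid homomorphism; its kernel is the norm group
  set f : (AdeleRing (𝓞 F) F)ˣ →* ℂˣ := (η : (AdeleRing (𝓞 F) F)ˣ →* ℂˣ)
  have hfη : ∀ x, f x = η x := fun x => rfl
  have hker : f.ker = normGroup F E := by
    ext x
    rw [MonoidHom.mem_ker, hfη]
    exact hη x
  -- index = #(𝔸ˣ/ker) = #range
  have hidx : (normGroup F E).index = Nat.card f.range := by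
    rw [← hker, Subgroup.index_eq_card]
    exact Nat.card_congr (QuotientGroup.quotientKerEquivRange f).toEquiv
  -- the range lies in `μ_n(ℂ)`
  have hpow_n : η ^ n = 1 := by rw [← hord]; exact pow_orderOf_eq_one η
  have hle : f.range ≤ rootsOfUnity n ℂ := by
    rintro _ ⟨x, rfl⟩
    rw [mem_rootsOfUnity, hfη, ← Literature.NumberTheory.GaloisRepresentations.HeckeCharacter.pow_apply,
      hpow_n, Literature.NumberTheory.GaloisRepresentations.HeckeCharacter.one_apply]
  have hdvd₁ : Nat.card f.range ∣ n := by
    have h := Subgroup.card_dvd_of_le hle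
    rwa [Complex.card_rootsOfUnity] at h
  -- conversely `η ^ #range = 1`, so `n = ord η ∣ #range`
  have hdvd₂ : n ∣ Nat.card f.range := by
    rw [← hord]
    refine orderOf_dvd_of_pow_eq_one (Literature.NumberTheory.GaloisRepresentations.HeckeCharacter.ext fun x => ?_)
    rw [Literature.NumberTheory.GaloisRepresentations.HeckeCharacter.pow_apply,
      Literature.NumberTheory.GaloisRepresentations.HeckeCharacter.one_apply, ← hfη]
    have hx : (⟨f x, ⟨x, rfl⟩⟩ : f.range) ^ Nat.card f.range = 1 := pow_card_eq_one'
    exact congrArg Subtype.val hx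
  rw [hidx]
  exact Nat.dvd_antisymm hdvd₁ hdvd₂

/-- **`exists_isClassFieldCharacter` implies the first inequality** `[E : F] ≤ (normGroup F E).index`
(Tate §8, Consequence 8.4, in the rendering with Mathlib's `Subgroup.index`; indeed the norm index
equality, `index_normGroup_eq_finrank_of_isClassFieldCharacter`): the reciprocity-level input of
`ArthurClozelBaseChange` contains the first inequality. [cite: TateGCFT1967, §8 Consequence 8.4] -/
theorem finrank_le_index_normGroup_of_exists_isClassFieldCharacter [IsGalois F E]
    [IsCyclic (E ≃ₐ[F] E)] (h : exists_isClassFieldCharacter (F := F) (E := E)) :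
    Module.finrank F E ≤ (normGroup F E).index := by
  obtain ⟨η, hη, hord⟩ := h
  exact (index_normGroup_eq_finrank_of_isClassFieldCharacter hη hord).ge

/-- **`exists_isClassFieldCharacter` implies that the norm group of a non-trivial cyclic
extension is proper** (Tate §8, Consequence 8.5 / Cor. 8.8 in idelic form).
[cite: TateGCFT1967, §8 Consequence 8.5] -/
theorem normGroup_ne_top_of_exists_isClassFieldCharacter [IsGalois F E] [IsCyclic (E ≃ₐ[F] E)]
    (h : exists_isClassFieldCharacter (F := F) (E := E)) (hEF : 1 < Module.finrank F E) :
    normGroup F E ≠ ⊤ :=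
  normGroup_ne_top_of_finrank_le_index (finrank_le_index_normGroup_of_exists_isClassFieldCharacter h) hEF

/-- With `exists_isClassFieldCharacter`, the norm index of a cyclic extension of number fields is
exactly `[E : F]` (both inequalities of class field theory, Tate §8 Consequence 8.4 and §9
Thm. 9.1, as contained in the reciprocity isomorphism §5.1 (B)).
[cite: TateGCFT1967, §5.1 Main Theorem (B)] -/
theorem index_normGroup_eq_finrank_of_exists_isClassFieldCharacter [IsGalois F E]
    [IsCyclic (E ≃ₐ[F] E)] (h : exists_isClassFieldCharacter (F := F) (E := E)) :
    (normGroup F E).index = Module.finrank F E := by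
  obtain ⟨η, hη, hord⟩ := h
  exact index_normGroup_eq_finrank_of_isClassFieldCharacter hη hord

end Bridge

end Literature.NumberTheory.Automorphic
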